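import Summits.BirchSwinnertonDyer.BirchSwinnertonDyer.Theorems.EdixhovenFibreFiveSevenStarredOptimalManinUnitFiveSevenValueExit
import Literature.NumberTheory.EllipticCurves.KatoAdditiveTwistedValueNeronIntegrality
import Literature.NumberTheory.EllipticCurves.RootNumberTwistProofs
import Literature.NumberTheory.EllipticCurves.ManinConstantClassCertificateTwist
import Literature.NumberTheory.EllipticCurves.MultiplicativeComponentGroupOrder
import Literature.NumberTheory.EllipticCurves.BSDRootNumberLocalTablesProofs
import HarnessLib

/-!
# F″ REDUCED: Kato's Néron-twisted integrality `kato_neron_isIntegral_twistedSymbolSum_of_additive_five_le`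
# ⟸ [level = conductor] + NÉRON `p`-INTEGRALITY OF THE DEPLETED TWISTED CRITICAL VALUES (the `L`-value form
# the F″ programme pieces assemble) (`--supports stmt-BirchSwinnertonDyer-22226`, helper; route EdixhovenFibreFiveSeven)

HONEST FRAMING. Route `EdixhovenFibreFiveSeven`, crux K★ `StarredOptimalManinUnitFiveSeven`
(stmt-BirchSwinnertonDyer-22226), line `kato-lever`: K★ ⟸ F″ (p581141) and F″ =
`Literature.NumberTheory.EllipticCurves.kato_neron_isIntegral_twistedSymbolSum_of_additive_five_le` is the ONE open
stub of the registered skeleton (cite-only, XL). The F″ programme (map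
`Cruxes/StarredOptimalManinUnitFiveSeven/Lines/kato-lever-F2-programme.md` §4; pieces landed by seats edix-p1 g5,
edix-p2 g4, edix-p4 g2/g3, edix-p5 g2, manin-p1 g8) produces, from Kato's value law in a Néron coordinate (P1,
cite-only) through the receptacle, the semi-local descent, the unit choices and the isogeny transport, the
`L`-VALUE statement

> **NIV** — for `V, f, p, m, χ` under F″'s binders and any entire `L` continuing the `(m·pN)`-inflated series of `χ̄`
> (`Kato2004.EulerSystemValues.IsDepletedTwistedL f m (p*N) χ⁻¹ L`): `∃ s, p ∤ s, s·L(1)/Ω⁺(V) ∈ ℤ̄` if `χ` is even,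
> `∃ s, p ∤ s, s·L(1)/(i·Ω⁻(V)) ∈ ℤ̄` if `χ` is odd.

THIS FILE proves, in the kernel, **F″ ⟸ NIV + [Carayol: the level of the newform of `V` is its conductor]**
(`IsNewformOf.level_eq_conductorNorm`, cite-only, needed only to know `p ∣ N` and `a_ℓ(V) = 0` at every `ℓ² ∣ N`
— F″ quantifies over an arbitrary level `N` carrying `IsNewformOf V f`). The Birch / Euler-depletion / Gauss-sum
bookkeeping is the sibling `…ValueExit` (p598918); the additive-prime facts (`ℓ² ∣ N(V) ⟺` additive `⟹ a_ℓ = 0`) are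
the tree's `natGenerator_sq_dvd_conductorNorm_iff`, `hasAdditiveReductionAt_int_iff_ringOfIntegers`,
`LFunction_apply_eq_zero_of_hasAdditiveReductionAt`, `sq_dvd_conductorNorm_of_not_good_of_not_mult`. So the crux's
stub F″ — and with it K★ by p581141 — is reduced BY NAME to NIV, the statement the programme's P1 ⊕ P2 ⊕ P3 ⊕ P4
⊕ units deliver. TOOL theorem only (no definition, no named fact, no `sorry`; NIV and Carayol's fact are DISPLAYED
HYPOTHESES); closes nothing by itself; BSD is not proved by any of this.

* `lFunction_eq_zero_of_sq_dvd_conductorNorm` — `ℓ² ∣ N(V) ⟹ a_ℓ(V) = 0` (`ℓ` prime).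
* ★ `kato_neron_of_depletedValueIntegral` — **F″ ⟸ [level = conductor] + NIV**.
* hence K★ ⟸ [level = conductor] + NIV by one `exact starredOptimalManinUnitFiveSeven_of_kato (…)` over p581141
  (not stated here: that closer imports the route file, and this helper stays route-independent).

References: K. Kato, Astérisque 295 (2004), (8.1.3), Thm. 9.7, Thm. 6.6 (1), §6.2 [Kato2004Asterisque]; C.-H. Kim,
K. Nakamura (2020), Cor. 2.4 [KimNakamura2020]; H. Carayol (1986) [Carayol1986]; B. Mazur, J. Tate, J. Teitelbaum
(1986), §I.8 [MazurTateTeitelbaum1986]; programme map `…/kato-lever-F2-programme.md` §4.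
-/

set_option autoImplicit false
-- the Theorems namespace of a single-conjunct summit repeats the summit name by design (D-0017)
set_option linter.dupNamespace false

noncomputable section

open scoped BigOperators Classical
open Complex CongruenceSubgroup IsDedekindDomain
open Literature.NumberTheory.EllipticCurves Literature.NumberTheory.EllipticCurves.ModularForms
open Literature.NumberTheory.EllipticCurves.Kato2004
open Summit.BirchSwinnertonDyer.BirchSwinnertonDyer.Theorems.StarredOptimalManinUnitFiveSevenValueExit

namespace Summit.BirchSwinnertonDyer.BirchSwinnertonDyer.Theorems.StarredOptimalManinUnitFiveSevenNIV

/-- **`ℓ² ∣ N(V) ⟹ a_ℓ(V) = 0`** for a prime `ℓ` (additive reduction at `ℓ`: Silverman ATAEC IV.10.2(c); the Euler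
factor at an additive prime is `1`). [cite: Silverman1994, IV.10.2(c)] -/
theorem lFunction_eq_zero_of_sq_dvd_conductorNorm (V : WeierstrassCurve ℚ) [V.IsElliptic] {q : ℕ} (hq : q.Prime)
    (hsq : q ^ 2 ∣ V.conductorNorm ℤ) : V.LFunction q = 0 := by
  haveI : Fact q.Prime := ⟨hq⟩
  have hgen : Rat.HeightOneSpectrum.natGenerator
      ((Rat.HeightOneSpectrum.primesEquiv (R := ℤ)).symm ⟨q, hq⟩) = q := natGenerator_primesEquiv_symm hq
  have hadd : V.HasAdditiveReductionAt ((Rat.HeightOneSpectrum.primesEquiv (R := ℤ)).symm ⟨q, hq⟩) := by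
    rw [← natGenerator_sq_dvd_conductorNorm_iff _ V, hgen]
    exact hsq
  rw [V.hasAdditiveReductionAt_int_iff_ringOfIntegers ⟨q, hq⟩] at hadd
  exact V.LFunction_apply_eq_zero_of_hasAdditiveReductionAt
    (v := (Rat.HeightOneSpectrum.primesEquiv (R := NumberField.RingOfIntegers ℚ)).symm ⟨q, hq⟩)
    (by rw [Equiv.apply_symm_apply]) hadd (dvd_refl q)

/-- ★ **F″ ⟸ [level = conductor] + NIV.** Kato's Néron-twisted integrality at an additive `p ≥ 5`
(`kato_neron_isIntegral_twistedSymbolSum_of_additive_five_le`, the crux's one stub) follows from Carayol's «the level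
of the newform of `V` is `N(V)`» (`IsNewformOf.level_eq_conductorNorm`, displayed hypothesis `hlev`) and the NÉRON
`p`-INTEGRALITY OF THE `(m·pN)`-DEPLETED TWISTED CRITICAL VALUES of `χ̄` under F″'s own binders (displayed hypothesis
`hNIV`, parity-split: `s·L(1)/Ω⁺(V) ∈ ℤ̄` for even `χ`, `s·L(1)/(i·Ω⁻(V)) ∈ ℤ̄` for odd `χ`, some `s` prime to `p`)
— the value exit `katoNeron_{even,odd}_of_depletedValue` applied at the entire continuation of the inflated
series (`exists_differentiable_eq_twistedLSeries_holds`), with `p ∣ N` and `a_ℓ = 0` at `ℓ² ∣ N` read off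
`N = N(V)`. [cite: Kato2004Asterisque, (8.1.3) (p. 180), Thm. 9.7 (p. 189), Thm. 6.6 (1) (p. 163)]
[cite: KimNakamura2020, Cor. 2.4] [cite: Carayol1986] [cite: MazurTateTeitelbaum1986, §I.8 (8.6)] -/
theorem kato_neron_of_depletedValueIntegral
    (hlev : ∀ {N : ℕ} [NeZero N], IsNewformOf.level_eq_conductorNorm (N := N))
    (hNIV : ∀ (V : WeierstrassCurve ℚ) [V.IsElliptic] [V.IsGloballyMinimal] {N : ℕ} [NeZero N]
      (f : CuspForm (Gamma0 N) 2) (_ : IsNewformOf V f) (p : ℕ) [Fact p.Prime] (_ : 5 ≤ p)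
      (_ : ¬ V.HasGoodReductionAtPrime p) (_ : ¬ V.HasMultiplicativeReductionAtPrime p)
      (_ : V.HasIrreducibleModPGaloisRep p) (m : ℕ) [NeZero m] (_ : m.Coprime (p * N))
      (_ : 7 < p ∨ (Nat.Coprime (orderOf (p : ZMod m)) (p - 1) ∧
        ∀ P : (V.baseChange ℚ_[p]).toAffine.Point, p • P = 0 → P = 0))
      (χ : DirichletCharacter ℂ m) (_ : χ.IsPrimitive) (_ : χ ≠ 1) (_ : ¬ p ∣ orderOf χ)
      (L : ℂ → ℂ) (_ : EulerSystemValues.IsDepletedTwistedL f m (p * N) χ⁻¹ L),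
      (χ.Even → ∃ s : ℕ, ¬ p ∣ s ∧ IsIntegral ℤ ((s : ℂ) * (L 1 / (V.realPeriodRat : ℂ)))) ∧
      (χ.Odd → ∃ s : ℕ, ¬ p ∣ s ∧ IsIntegral ℤ ((s : ℂ) * (L 1 / (Complex.I * (V.imaginaryPeriodRat : ℂ)))))) :
    kato_neron_isIntegral_twistedSymbolSum_of_additive_five_le := by
  intro V _ _ N _ f hf p _ h5 hng hnm hirr m _ hm hKP χ hχ hχ1 hord ϖ r
  -- `N = N(V)`: `p ∣ N` and `a_ℓ(V) = 0` at every `ℓ² ∣ N`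
  have hN : N = V.conductorNorm ℤ := hlev hf
  have hpN : p ∣ N := by
    rw [hN]
    exact (dvd_pow_self p two_ne_zero).trans (sq_dvd_conductorNorm_of_not_good_of_not_mult ⟨hng, hnm⟩)
  have hsq : ∀ q ∈ N.primeFactors, q ^ 2 ∣ N → V.LFunction q = 0 := fun q hq hq2 =>
    lFunction_eq_zero_of_sq_dvd_conductorNorm V (Nat.prime_of_mem_primeFactors hq) (hN ▸ hq2)
  -- the entire continuation of the `(m·pN)`-inflated series of `χ̄`
  haveI : NeZero (m * (p * N)) := ⟨mul_ne_zero (NeZero.ne m) (mul_ne_zero (Fact.out : p.Prime).ne_zero (NeZero.ne N))⟩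
  obtain ⟨L, hLd, hLs⟩ := exists_differentiable_eq_twistedLSeries_holds f
    (DirichletCharacter.changeLevel (dvd_mul_right m (p * N)) χ⁻¹)
  have hL : EulerSystemValues.IsDepletedTwistedL f m (p * N) χ⁻¹ L := ⟨hLd, hLs⟩
  obtain ⟨heven, hodd⟩ := hNIV V f hf p h5 hng hnm hirr m hm hKP χ hχ hχ1 hord L hL
  refine ⟨fun hev hϖ hr => ?_, fun hod hϖ hr => ?_⟩
  · exact katoNeron_even_of_depletedValue V hf hpN hsq hm hχ hL (heven hev) hϖ hr
  · exact katoNeron_odd_of_depletedValue V hf hpN hsq hm hχ hL (hodd hod) hϖ hr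

end Summit.BirchSwinnertonDyer.BirchSwinnertonDyer.Theorems.StarredOptimalManinUnitFiveSevenNIV

end
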